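import Summits.HodgeConjecture.CorCM.GaloisCertificateQuotientLift
import Summits.HodgeConjecture.CorCM.GaloisDegenerateSplitExtension
import Summits.HodgeConjecture.CorCM.GaloisLeftStabiliserInducedType
import HarnessLib

/-!
# BAD ascends along EVERY Galois CM extension of degree `≥ 3`: `K ⊇ K₀` Galois CM fields, `[K : K₀] ≥ 3`,
# `K₀` has a primitive degenerate CM type ⟹ so has `K` — equivalently GOOD(K) ⟹ GOOD(K₀)

COR-CM (cell `pub-hodgecm2`), binder seat b04 (gen 31), count-neutral own lane «Galois-CM-type classification»; the FIELD FORM of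
`CorCM/GaloisCertificateQuotientLift` (which needs no splitting), superseding the split / coprime hypotheses of
`CorCM/GaloisDegenerateSplitExtension` and `CorCM/GaloisDegenerateCoprimeQuotient` (same session).  KERNEL ONLY: theorems; no
definition, no named fact, no `sorry`.  `HC_CM` is neither used nor claimed.

THEOREMS (`K` a Galois CM field; conclusion always: `K` carries a SIMPLE DEGENERATE abelian variety of dimension `[K:ℚ]/2` with
CM by `K`, i.e. a primitive degenerate CM type realised by a simple CM abelian variety with a rational `(p,p)` class outside the
divisor ring on some power):
* **`exists_simple_degenerate_of_subfield`** — `K₀` a Galois CM field with `K ⊇ K₀ ⊇ ℚ` (`[Algebra K₀ K] [IsScalarTower ℚ K₀ K]`),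
  `[K : K₀] ≥ 3`, and `K₀` has a PRIMITIVE DEGENERATE CM type.  Proof: the restriction `Gal(K/ℚ) → Gal(K₀/ℚ)` is onto
  (Mathlib `AlgEquiv.restrictNormalHom_surjective`) with kernel `Gal(K/K₀)` of order `[K:K₀] ≥ 3` and maps `c` to `c`
  (`restrictNormalHom_complexConj_of_tower`); the degenerate type of `K₀` reads as an integer certificate
  (`exists_certificate_of_not_isNondegenerate`), which lifts by `QuotientLift.exists_liftQ_certificate`.
* **`exists_simple_degenerate_of_intermediateField`** — the same for `K₀ : IntermediateField ℚ K`.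
* **`exists_simple_degenerate_of_fixedField`** — `N ◁ Gal(K/ℚ)`, `c ∉ N`, `|N| ≥ 3`, `K^N` BAD ⟹ `K` BAD;
  **`exists_simple_degenerate_of_fixedField_odd`** — `N ◁ Gal(K/ℚ)` of odd order `≠ 1` (then `c ∉ N` automatically).
So, for the classification: **GOOD is inherited by every Galois CM quotient field of index `≥ 3`**, BAD by every Galois CM
extension of degree `≥ 3`: if the Hodge rings of all powers of all simple CM abelian varieties with CM by `K` are generated by
divisor classes (`B = D`), then so are those for every Galois CM subfield `K₀` with `[K:K₀] ≥ 3` (BAD = an exceptional Hodge class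
on some power, whose algebraicity stays open; BAD does not refute the Hodge conjecture).  Examples now BAD by name: `C_{p^k} ⋊ C₈`- and `Q₈ × C_{p^k}`-fields over
BAD `C_p ⋊ C₈`- / `Q₈ × C_p`-fields (`k ≥ 2`, previously in the «arithmetic residue»), `(C₃ ⋊ C₈)`-towers, every `N.Γ`
(split or not) with `|N| ≥ 3`, `c ∉ N`, over a BAD `Γ`-field.  The quadratic case `[K:K₀] = 2` is
`CorCM/GaloisDegenerateRealQuadraticFactor` (split through `c`, `Gal(K₀/ℚ)` not of exponent `2`); in general it is OPEN here
(no GOOD Galois CM field with a BAD Galois CM subfield of index `2` is known to the lineage).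

## References

* [Kubota1965] T. Kubota, *On the field extension by complex multiplication*, Trans. AMS 118 (1965), §2, §4 Lemma 2.
* [Shimura1998] G. Shimura, *Abelian Varieties with Complex Multiplication and Modular Functions*, §6.2 Thm. 3, §8.2 Prop. 26,
  §18.2 Lemma (i).
* [Gordon1999HodgeAVSurvey] B. B. Gordon, *A survey of the Hodge conjecture for abelian varieties*, Thm. 6.4, §9.3.
* [Streng2010] M. Streng, *Complex multiplication of abelian surfaces*, Ch. I Lemma 2.2 (d).
-/

noncomputable section

open CategoryTheory CategoryTheory.Limits NumberField
open scoped BigOperators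

namespace Summit.HodgeConjecture.CorCM.GaloisModels

open Literature.NumberTheory.ComplexMultiplication
open Literature.AlgebraicGeometry.Motives (AbelianVariety CMType)
open Literature.AlgebraicGeometry.HodgeTheory
open Literature.AlgebraicGeometry.ComplexMultiplication (IsCMTypeRealisation)
open Literature.AlgebraicGeometry.Pohlmann1968
open Literature.Barriers.HodgeConjecture (divisorClassesSpan)
open Summit.HodgeConjecture.CorCM.GaloisRank

section Field

variable {K : Type} [Field K] [NumberField K] [IsCMField K] [IsGalois ℚ K]

/-- **BAD ASCENDS ALONG EVERY GALOIS CM EXTENSION OF DEGREE `≥ 3`.**  `K ⊇ K₀ ⊇ ℚ` Galois CM fields with `[K : K₀] ≥ 3`; if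
`K₀` has a PRIMITIVE DEGENERATE CM type then `K` carries a SIMPLE DEGENERATE abelian variety of dimension `[K:ℚ]/2` with CM by
`K` (a rational `(p,p)` class outside the divisor ring on some power).  No splitting, no coprimality.
[cite: Kubota1965, §2 and §4 Lemma 2] [cite: Shimura1998, §6.2 Thm. 3 and §8.2 Prop. 26] [cite: Gordon1999HodgeAVSurvey, Thm. 6.4 and §9.3] -/
theorem exists_simple_degenerate_of_subfield (K₀ : Type) [Field K₀] [NumberField K₀] [IsCMField K₀] [IsGalois ℚ K₀]
    [Algebra K₀ K] [IsScalarTower ℚ K₀ K] (hdeg : 3 ≤ Module.finrank K₀ K)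
    (Φ₀ : CMType K₀) (φ₀ : K₀ →+* ℂ) (hprim : IsPrimitive (ℂ ≃+* ℂ) Φ₀.1 φ₀) (hndg : ¬ IsNondegenerate Φ₀) :
    ∃ (Φ : CMType K) (φ : K →+* ℂ) (X : AbelianVariety ℂ) (ι : 𝓞 K →+* End X)
      (ϑ : K →+* Module.End ℂ (complexBetti X.X 1)),
      IsPrimitive (ℂ ≃+* ℂ) Φ.1 φ ∧ ¬ IsNondegenerate Φ ∧ IsCMTypeRealisation Φ X ι ϑ ∧ X.IsSimple ∧
      X.dim = Module.finrank ℚ K / 2 ∧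
      ∃ m p : ℕ, ∃ y : complexBetti (⨁ fun _ : Fin m => X).X (2 * p), IsRationalClass y ∧
        IsOfHodgeType (⨁ fun _ : Fin m => X).dim (⨁ fun _ : Fin m => X).X (2 * p) p p y ∧
        y ∉ divisorClassesSpan (⨁ fun _ : Fin m => X).X (⨁ fun _ : Fin m => X).dim p := by
  classical
  -- two distinct non-trivial elements of `Gal(K/K₀)`, restricting trivially to `K₀`
  haveI : IsGalois K₀ K := IsGalois.tower_top_of_isGalois ℚ K₀ K
  have hcard : 2 < Nat.card (K ≃ₐ[K₀] K) := by rw [IsGalois.card_aut_eq_finrank]; omega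
  haveI : Finite (K ≃ₐ[K₀] K) := Nat.finite_of_card_ne_zero (by omega)
  letI : Fintype (K ≃ₐ[K₀] K) := Fintype.ofFinite _
  rw [Nat.card_eq_fintype_card] at hcard
  obtain ⟨g₁, g₂, hg₁, hg₂, hg₁₂⟩ : ∃ g₁ g₂ : K ≃ₐ[K₀] K, g₁ ≠ 1 ∧ g₂ ≠ 1 ∧ g₁ ≠ g₂ := by
    obtain ⟨a, b, c, hab, hac, hbc⟩ := Fintype.two_lt_card_iff.1 hcard
    by_cases ha : a = 1
    · exact ⟨b, c, fun h => hab (ha.trans h.symm), fun h => hac (ha.trans h.symm), hbc⟩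
    · by_cases hb : b = 1
      · exact ⟨a, c, ha, fun h => hbc (hb.trans h.symm), hac⟩
      · exact ⟨a, b, ha, hb, hab⟩
  have hinj : Function.Injective (AlgEquiv.restrictScalars ℚ : (K ≃ₐ[K₀] K) → (K ≃ₐ[ℚ] K)) :=
    AlgEquiv.restrictScalars_injective ℚ
  have hone : ((1 : K ≃ₐ[K₀] K).restrictScalars ℚ : K ≃ₐ[ℚ] K) = 1 := AlgEquiv.ext fun x => rfl
  have h₁ : (g₁.restrictScalars ℚ : K ≃ₐ[ℚ] K) ≠ 1 := fun h => hg₁ (hinj (h.trans hone.symm))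
  have h₂ : (g₂.restrictScalars ℚ : K ≃ₐ[ℚ] K) ≠ 1 := fun h => hg₂ (hinj (h.trans hone.symm))
  have h₁₂ : (g₁.restrictScalars ℚ : K ≃ₐ[ℚ] K) ≠ g₂.restrictScalars ℚ := fun h => hg₁₂ (hinj h)
  -- the certificate of `K₀`, read on `Gal(K₀/ℚ)` itself
  obtain ⟨T₀, b, -, hcm, hprim', hanti, hann, hb⟩ :=
    exists_certificate_of_not_isNondegenerate (MulEquiv.refl (K₀ ≃ₐ[ℚ] K₀))
      (c₀ := (IsCMField.complexConj K₀).restrictScalars ℚ) rfl Φ₀ φ₀ hprim hndg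
  obtain ⟨Φ, φ, X, ι, ϑ, H1, H2, H3, H4, H5, H6⟩ :=
    exists_simple_degenerate_of_quotient_certificate (MulEquiv.refl (K ≃ₐ[ℚ] K)) (AlgEquiv.restrictNormalHom K₀)
      (AlgEquiv.restrictNormalHom_surjective K) (n₁ := g₁.restrictScalars ℚ) (n₂ := g₂.restrictScalars ℚ)
      (restrictNormalHom_restrictScalars_eq_one K₀ g₁) (restrictNormalHom_restrictScalars_eq_one K₀ g₂) h₁ h₂ h₁₂
      ((IsCMField.complexConj K₀).restrictScalars ℚ)
      (by rw [MulEquiv.refl_apply, restrictNormalHom_complexConj_of_tower K₀]) T₀ hcm hprim' b hanti hann hb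
  refine ⟨Φ, φ, X, ι, ϑ, H1, H2, H3, H4, ?_, H6⟩
  rw [H5, card_model_eq_finrank (MulEquiv.refl (K ≃ₐ[ℚ] K))]

/-- **… for an intermediate field** `K₀ ≤ K`, Galois CM over `ℚ`, with `[K : K₀] ≥ 3`. [cite: Kubota1965, §2 and §4 Lemma 2]
[cite: Shimura1998, §6.2 Thm. 3 and §8.2 Prop. 26] [cite: Gordon1999HodgeAVSurvey, Thm. 6.4 and §9.3] -/
theorem exists_simple_degenerate_of_intermediateField (K₀ : IntermediateField ℚ K) [IsCMField K₀] [IsGalois ℚ K₀]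
    (hdeg : 3 ≤ Module.finrank K₀ K) (Φ₀ : CMType K₀) (φ₀ : K₀ →+* ℂ) (hprim : IsPrimitive (ℂ ≃+* ℂ) Φ₀.1 φ₀)
    (hndg : ¬ IsNondegenerate Φ₀) :
    ∃ (Φ : CMType K) (φ : K →+* ℂ) (X : AbelianVariety ℂ) (ι : 𝓞 K →+* End X)
      (ϑ : K →+* Module.End ℂ (complexBetti X.X 1)),
      IsPrimitive (ℂ ≃+* ℂ) Φ.1 φ ∧ ¬ IsNondegenerate Φ ∧ IsCMTypeRealisation Φ X ι ϑ ∧ X.IsSimple ∧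
      X.dim = Module.finrank ℚ K / 2 ∧
      ∃ m p : ℕ, ∃ y : complexBetti (⨁ fun _ : Fin m => X).X (2 * p), IsRationalClass y ∧
        IsOfHodgeType (⨁ fun _ : Fin m => X).dim (⨁ fun _ : Fin m => X).X (2 * p) p p y ∧
        y ∉ divisorClassesSpan (⨁ fun _ : Fin m => X).X (⨁ fun _ : Fin m => X).dim p :=
  exists_simple_degenerate_of_subfield K₀ hdeg Φ₀ φ₀ hprim hndg

/-- **… for a fixed field `K^N`**: `N ◁ Gal(K/ℚ)` with complex conjugation `∉ N` and `|N| ≥ 3`; `K^N` (Galois CM) has a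
primitive degenerate CM type ⟹ `K` is BAD. [cite: Kubota1965, §2 and §4 Lemma 2] [cite: Shimura1998, §6.2 Thm. 3 and §8.2 Prop. 26]
[cite: Gordon1999HodgeAVSurvey, Thm. 6.4 and §9.3] -/
theorem exists_simple_degenerate_of_fixedField (N : Subgroup (K ≃ₐ[ℚ] K)) [N.Normal]
    (hc : (IsCMField.complexConj K).restrictScalars ℚ ∉ N) (hN : 3 ≤ Nat.card N)
    (Φ₀ : CMType (IntermediateField.fixedField N)) (φ₀ : IntermediateField.fixedField N →+* ℂ)
    (hprim : IsPrimitive (ℂ ≃+* ℂ) Φ₀.1 φ₀) (hndg : ¬ IsNondegenerate Φ₀) :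
    ∃ (Φ : CMType K) (φ : K →+* ℂ) (X : AbelianVariety ℂ) (ι : 𝓞 K →+* End X)
      (ϑ : K →+* Module.End ℂ (complexBetti X.X 1)),
      IsPrimitive (ℂ ≃+* ℂ) Φ.1 φ ∧ ¬ IsNondegenerate Φ ∧ IsCMTypeRealisation Φ X ι ϑ ∧ X.IsSimple ∧
      X.dim = Module.finrank ℚ K / 2 ∧
      ∃ m p : ℕ, ∃ y : complexBetti (⨁ fun _ : Fin m => X).X (2 * p), IsRationalClass y ∧
        IsOfHodgeType (⨁ fun _ : Fin m => X).dim (⨁ fun _ : Fin m => X).X (2 * p) p p y ∧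
        y ∉ divisorClassesSpan (⨁ fun _ : Fin m => X).X (⨁ fun _ : Fin m => X).dim p := by
  haveI : IsCMField (IntermediateField.fixedField N) := isCMField_fixedField_of_not_mem N hc
  haveI : IsGalois ℚ (IntermediateField.fixedField N) := IsGalois.of_fixedField_normal_subgroup N
  exact exists_simple_degenerate_of_subfield (IntermediateField.fixedField N)
    (by rw [IntermediateField.finrank_fixedField_eq_card]; exact hN) Φ₀ φ₀ hprim hndg

/-- **… for a normal subgroup of ODD order `≠ 1`** (then complex conjugation, of order `2`, is not in `N`).
[cite: Kubota1965, §2 and §4 Lemma 2] [cite: Shimura1998, §6.2 Thm. 3 and §8.2 Prop. 26] [cite: Gordon1999HodgeAVSurvey, Thm. 6.4 and §9.3] -/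
theorem exists_simple_degenerate_of_fixedField_odd (N : Subgroup (K ≃ₐ[ℚ] K)) [N.Normal] (hodd : Odd (Nat.card N))
    (hN : N ≠ ⊥) (Φ₀ : CMType (IntermediateField.fixedField N)) (φ₀ : IntermediateField.fixedField N →+* ℂ)
    (hprim : IsPrimitive (ℂ ≃+* ℂ) Φ₀.1 φ₀) (hndg : ¬ IsNondegenerate Φ₀) :
    ∃ (Φ : CMType K) (φ : K →+* ℂ) (X : AbelianVariety ℂ) (ι : 𝓞 K →+* End X)
      (ϑ : K →+* Module.End ℂ (complexBetti X.X 1)),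
      IsPrimitive (ℂ ≃+* ℂ) Φ.1 φ ∧ ¬ IsNondegenerate Φ ∧ IsCMTypeRealisation Φ X ι ϑ ∧ X.IsSimple ∧
      X.dim = Module.finrank ℚ K / 2 ∧
      ∃ m p : ℕ, ∃ y : complexBetti (⨁ fun _ : Fin m => X).X (2 * p), IsRationalClass y ∧
        IsOfHodgeType (⨁ fun _ : Fin m => X).dim (⨁ fun _ : Fin m => X).X (2 * p) p p y ∧
        y ∉ divisorClassesSpan (⨁ fun _ : Fin m => X).X (⨁ fun _ : Fin m => X).dim p := by
  have hcc := model_complexConj_mul_self (K := K) (MulEquiv.refl _) rfl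
  have hc1 := model_complexConj_ne_one (K := K) (MulEquiv.refl _) rfl
  rw [MulEquiv.refl_apply] at hcc hc1
  have hcN : (IsCMField.complexConj K).restrictScalars ℚ ∉ N := fun hc => by
    have h2 : orderOf ((IsCMField.complexConj K).restrictScalars ℚ) = 2 :=
      orderOf_eq_prime (by rw [pow_two]; exact hcc) hc1
    have hd : orderOf ((IsCMField.complexConj K).restrictScalars ℚ) ∣ Nat.card N := by
      have := orderOf_dvd_natCard (⟨_, hc⟩ : N)
      rwa [← Subgroup.orderOf_coe] at this
    rw [h2] at hd
    exact (Nat.not_even_iff_odd.2 hodd) (even_iff_two_dvd.2 hd)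
  refine exists_simple_degenerate_of_fixedField N hcN ?_ Φ₀ φ₀ hprim hndg
  have h1 : Nat.card N ≠ 1 := fun h => hN ((Subgroup.eq_bot_iff_card N).2 h)
  obtain ⟨k, hk⟩ := hodd
  omega

end Field

end Summit.HodgeConjecture.CorCM.GaloisModels

end
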